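/-
Copyright: rh-split cell (dbn column, prover seat l19-w2) gen 0, 2026-08-27.  LINE 3 «two-ray Laguerre
squeeze» of ideator rh-idea-2 (D-0145): glue.  The linear-factor ray is an RH-STRENGTHENING conjunct;
`¬Ray` statements are RH-free negative-side structure.  Nothing here bears on the truth of RH.
-/
import Summits.RiemannHypothesis.RiemannHypothesis.Theorems.Splittings.LinearRaySwing
import Summits.RiemannHypothesis.RiemannHypothesis.Theses.DBN
import HarnessLib

/-!
# LINE 3 glue: the squeeze SUPPLY gives `LinearRayLargeA`, the finite witness gives `¬Ray(25)`

With the swing lemma `DBN.LinearRaySwingLemma` now a THEOREM (`LinearRaySwing.linearRaySwingLemma`,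
stmt-RiemannHypothesis-22393 closed), rh-idea-2's seat glue `largeA_of_squeeze` / `not_ray25_of_witness` loses
its swing-lemma hypothesis:

* `linearRayLargeA_of_typicalGapSqueezeSupply : DBN.TypicalGapSqueezeSupply → DBN.LinearRayLargeA` — for
  `a > 21`, assuming the ray, RH holds (`LinearRayTwoPoint.riemannHypothesis_of_linearRay`, the ray is
  RH-strengthening), the supply (crux stmt-RiemannHypothesis-22394) gives a pair of consecutive simple zeros on
  which `F_a` is nowhere squeezed, contradicting the swing lemma.  So the open crux `LinearRayLargeA`
  (stmt-RiemannHypothesis-21579) is REDUCED to the supply crux 22394.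
* `not_hasOnlyRealZeros_linearFactorH_twentyFive_of_witness :
  DBN.TypicalGapSqueezeWitness25 → ¬ HasOnlyRealZeros (linearFactorH 25)` — the certified-numerics target
  (stmt-RiemannHypothesis-22511, the Lehman bump at `t ≈ 71732.9`) refutes the ray at `a = 25` by the same lemma.

Pure logic over the tree; no `sorry`, no new axioms, no instances, no notation, no definitions.  RH is not
proved by any of this; nothing here bears on the truth of RH.
-/

set_option linter.dupNamespace false  -- the mandated namespace repeats `RiemannHypothesis`

namespace Summit.RiemannHypothesis.RiemannHypothesis.Theorems.Splittings.LinearRaySwing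

open Literature.NumberTheory.LFunctions
open Literature.Barriers.RiemannHypothesis (linearFactorH)
open Summit.RiemannHypothesis.RiemannHypothesis.Theorems.Splittings

/-- **LINE 3 reduction**: the typical-gap squeeze supply (crux `DBN.TypicalGapSqueezeSupply`) implies
`DBN.LinearRayLargeA` (no member `a > 21` of the linear-factor ray is hyperbolic), by the swing lemma and
`LinearRayTwoPoint.riemannHypothesis_of_linearRay`. -/
theorem linearRayLargeA_of_typicalGapSqueezeSupply
    (hS : Summit.RiemannHypothesis.RiemannHypothesis.Theses.DBN.TypicalGapSqueezeSupply) :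
    Summit.RiemannHypothesis.RiemannHypothesis.Theses.DBN.LinearRayLargeA := by
  intro a ha hRay
  have ha0 : 0 < a := by linarith
  have hRH : Summit.RiemannHypothesis := LinearRayTwoPoint.riemannHypothesis_of_linearRay ha0 hRay
  obtain ⟨x₁, x₂, hx, haδ, hx₁, hx₂, hd₁, hd₂, hgap, hbig⟩ := hS a ha hRH
  obtain ⟨y, hy, hle⟩ := linearRaySwingLemma ha0 hRay hx haδ hx₁ hx₂ hd₁ hd₂ hgap
  exact absurd (hbig y hy) (not_lt.2 hle)

/-- **LINE 3 finite witness ⟹ `¬Ray(25)`**: the squeeze witness at `a = 25` (target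
`DBN.TypicalGapSqueezeWitness25`) refutes `HasOnlyRealZeros (linearFactorH 25)` by the swing lemma. -/
theorem not_hasOnlyRealZeros_linearFactorH_twentyFive_of_witness
    (hW : Summit.RiemannHypothesis.RiemannHypothesis.Theses.DBN.TypicalGapSqueezeWitness25) :
    ¬ HasOnlyRealZeros (linearFactorH 25) := by
  intro hRay
  obtain ⟨x₁, x₂, -, hx, haδ, hx₁, hx₂, hd₁, hd₂, hgap, hbig⟩ := hW
  obtain ⟨y, hy, hle⟩ :=
    linearRaySwingLemma (a := 25) (by norm_num) hRay hx haδ hx₁ hx₂ hd₁ hd₂ hgap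
  exact absurd (hbig y hy) (not_lt.2 hle)

end Summit.RiemannHypothesis.RiemannHypothesis.Theorems.Splittings.LinearRaySwing
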